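import Literature.Probability.LatticeModels.LatticeLaplacian
import HarnessLib

/-!
# Stability of the discrete Poisson problem: `|Δ e| ≤ η` inside, `|e| ≤ B` on the boundary

Topic `Literature/Probability/LatticeModels` (discrete potential theory on `ℤ²`, continuing
`LatticeLaplacian.lean`; the "stability" half of the consistency-and-stability proof that lattice
harmonic functions converge to a smooth harmonic function, on the discharge path of
`Kenyon2000_flatEdgePoissonKernelLimit`, cf. Kenyon 2000, proof of Lemma 17: "choose constants
`B₂, B₃` sufficiently large so that `Δ_ε(B₂ε⁴(Re v)² + H - H₀ - g) ≥ 0` … by the maximum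
principle … `|H - H₀ - g| = O(ε)`"). PROVED here:

* `latticeLaplacian_sqDist` — the lattice paraboloid `Q(v) = (v₀ - c₀)² + (v₁ - c₁)²` has
  `Δ Q = 4`;
* **`abs_le_of_abs_latticeLaplacian_le`** — if `S ⊆ ℤ²` is finite, `|Δ e| ≤ η` on `S`,
  `|e| ≤ B` on the outer boundary `∂S`, and `∂S` lies in the sup-norm box of radius `N`
  about `c`, then `|e| ≤ B + η N²/2` on `S` (maximum principle for the subharmonic functions
  `± e + (η/4) Q`, `0 ≤ Q ≤ 2N²`).

With `η = O(δ⁴)` (Taylor consistency of a smooth harmonic function sampled on `δℤ²`) and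
`N = O(1/δ)` (a bounded domain) the error term is `O(δ²)`. Everything is proved, [folklore]; no
named fact.

## References

* R. Kenyon, *Conformal invariance of domino tiling*, Ann. Probab. 28 (2000), proof of Lemma 17
  [Kenyon2000].
* R. Courant, K. Friedrichs, H. Lewy, Math. Ann. 100 (1928), §2 (the method) [folklore].
-/

noncomputable section

namespace Literature.Probability.LatticeModels

open Finset

/-- The lattice paraboloid `Q(v) = (v₀ - c₀)² + (v₁ - c₁)²` about the site `c`. [folklore] -/
def sqDist (c : Site 2) (v : Site 2) : ℝ := ((v 0 : ℤ) - c 0 : ℝ) ^ 2 + ((v 1 : ℤ) - c 1 : ℝ) ^ 2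

/-- `Q ≥ 0`. [folklore] -/
theorem sqDist_nonneg (c v : Site 2) : 0 ≤ sqDist c v := by unfold sqDist; positivity

/-- `Q ≤ 2N²` on the sup-norm box of radius `N` about `c`. [folklore] -/
theorem sqDist_le {c v : Site 2} {N : ℝ} (h0 : |((v 0 : ℤ) : ℝ) - c 0| ≤ N)
    (h1 : |((v 1 : ℤ) : ℝ) - c 1| ≤ N) : sqDist c v ≤ 2 * N ^ 2 := by
  unfold sqDist
  have e0 : (((v 0 : ℤ) : ℝ) - c 0) ^ 2 ≤ N ^ 2 := by
    rw [← sq_abs]; exact pow_le_pow_left₀ (abs_nonneg _) h0 2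
  have e1 : (((v 1 : ℤ) : ℝ) - c 1) ^ 2 ≤ N ^ 2 := by
    rw [← sq_abs]; exact pow_le_pow_left₀ (abs_nonneg _) h1 2
  linarith

/-- **`Δ Q = 4`**: each coordinate contributes `(t+1)² + (t-1)² - 2t² = 2`. [folklore] -/
theorem latticeLaplacian_sqDist (c v : Site 2) : latticeLaplacian (sqDist c) v = 4 := by
  rw [latticeLaplacian_eq, Fin.sum_univ_four]
  simp only [sqDist, cornerUnit, Pi.add_apply, Pi.neg_apply, Pi.single_eq_same,
    Pi.single_eq_of_ne (show (1 : Fin 2) ≠ 0 by decide),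
    Pi.single_eq_of_ne (show (0 : Fin 2) ≠ 1 by decide), add_zero, neg_zero, Int.cast_add,
    Int.cast_one, Int.cast_neg]
  ring

/-- **Stability of the discrete Poisson problem.** Let `S ⊆ ℤ²` be finite, `|Δ e| ≤ η` on `S`,
`|e| ≤ B` on the outer boundary of `S`, and suppose every site of the outer boundary of `S`
lies in the sup-norm box of radius `N` about `c`. Then `|e v| ≤ B + η N²/2` for all `v ∈ S`.
Proof: `e + (η/4)Q` and `-e + (η/4)Q` are subharmonic on `S` (`Δ Q = 4`), at most `B + (η/4)·2N²`
on the outer boundary, hence on `S` by the maximum principle; and `Q ≥ 0`. (Kenyon 2000, proof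
of Lemma 17; Courant–Friedrichs–Lewy 1928.) [cite: Kenyon2000, proof of Lemma 17] -/
theorem abs_le_of_abs_latticeLaplacian_le {S : Set (Site 2)} (hS : S.Finite) {e : Site 2 → ℝ}
    {η B N : ℝ} (hη : 0 ≤ η) {c : Site 2}
    (hΔ : ∀ v ∈ S, |latticeLaplacian e v| ≤ η)
    (hB : ∀ w ∈ latticeOuterBoundary S, |e w| ≤ B)
    (hboxB : ∀ w ∈ latticeOuterBoundary S, |((w 0 : ℤ) : ℝ) - c 0| ≤ N ∧ |((w 1 : ℤ) : ℝ) - c 1| ≤ N)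
    {v : Site 2} (hv : v ∈ S) : |e v| ≤ B + η * N ^ 2 / 2 := by
  -- the two comparison functions `± e + (η/4) Q`
  have key : ∀ (f : Site 2 → ℝ), (∀ v ∈ S, -η ≤ latticeLaplacian f v) →
      (∀ w ∈ latticeOuterBoundary S, f w ≤ B) → f v ≤ B + η * N ^ 2 / 2 := by
    intro f hf hfB
    set u : Site 2 → ℝ := fun x => f x + (η / 4) * sqDist c x with hu
    have hsub : IsLatticeSubharmonicOn u S := by
      intro x hx
      have h1 : latticeLaplacian u x = latticeLaplacian f x + (η / 4) * latticeLaplacian (sqDist c) x := by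
        have : u = f + fun y => (η / 4) * sqDist c y := by funext y; simp [hu]
        rw [this, latticeLaplacian_add, latticeLaplacian_const_mul]
      rw [h1, latticeLaplacian_sqDist]
      have := hf x hx
      linarith
    have hbd : ∀ w ∈ latticeOuterBoundary S, u w ≤ B + η * N ^ 2 / 2 := by
      intro w hw
      have hQ := sqDist_le (hboxB w hw).1 (hboxB w hw).2
      have h1 := hfB w hw
      simp only [hu]
      nlinarith
    have h := hsub.le_of_forall_boundary_le hS hbd v hv
    simp only [hu] at h
    have hQ0 := sqDist_nonneg c v
    nlinarith
  have h1 := key e (fun x hx => (abs_le.1 (hΔ x hx)).1) (fun w hw => (abs_le.1 (hB w hw)).2)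
  have h2 := key (-e) (fun x hx => by
      rw [latticeLaplacian_neg]; linarith [(abs_le.1 (hΔ x hx)).2])
    (fun w hw => by rw [Pi.neg_apply]; linarith [(abs_le.1 (hB w hw)).1])
  rw [Pi.neg_apply] at h2
  exact abs_le.2 ⟨by linarith, h1⟩

end Literature.Probability.LatticeModels
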